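import Literature.AlgebraicGeometry.Modules.UnitCocycle
import Literature.AlgebraicGeometry.Modules.SheafHom
import Mathlib.Algebra.Category.ModuleCat.Presheaf.Submodule
import Mathlib.Topology.Sheaves.SheafCondition.UniqueGluing
import HarnessLib

/-!
# Venture HSemireg — route R1.0 (untwisted reading): the twist `F ↦ F ⊗ M` by a line bundle `M`,
# CONSTRUCTED on real carriers as the cocycle twist `F⟨c⟩` (th-4 file #11)

HONEST FRAMING. A construction in Mathlib's abelian category `X.Modules` of ALL sheaves of `𝒪_X`-modules on a
scheme `X`, on the tree's Čech carriers (`Modules/UnitCocycle.lean`). Nothing is asserted about any variety; no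
gerbe is constructed; nothing here says HC, HC_CM or HC_AV is proved.

WHAT AND WHY. Route R1.0 of `general-structure/PERRY-SUBSTITUTE-GS.md` (the `μ₂`-gerbe untwisting step) is in the
tree as ten kind-proof files (`Untwist*.lean`, map `theory/TH4-LEAN-MAP.md`) in which every FUNCTOR is a binder:
in the untwisted reading of record (lead R-49(a)/R-51(a): on the fibres where the `B`-field class is integral,
`E₀′ = E₀ ⊗ M_B` on `X₀` itself, `M_B` a LINE BUNDLE) the identification
`θ : Ext²_{X₀}(E₀, E₀) ⥲ Ext²_{X₀}(E₀′, E₀′)` (by value `18 → 18` at the `g = 4` anchor) is `Φ.functor.mapExtAddHom`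
for an ASSUMED autoequivalence `Φ` «intended `- ⊗ M_B`» (`UntwistExtEquivalence.lean`), because the tree's tensor
product of `𝒪_X`-modules (`Modules/TensorProduct.lean`) has neither associator nor inverse-line-bundle calculus.
This file and its sequel CONSTRUCT that functor without tensor products, by Čech gluing — the device of
`Modules/LineBundleOfCocycle.lean` and `Modules/SerreTwistMod.lean` ("constructed CONCRETELY, without tensor
products") applied to an arbitrary module: for a Čech `1`-cocycle of units `c = (U_x, g_{xy})` on a point-indexed
open cover (`Modules.UnitCocycle`; its class in `Ȟ¹(X, 𝒪_X^×)` is that of `M = lineBundle c`, Hartshorne III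
Ex. 4.5) and an `𝒪_X`-module `F`, the **cocycle twist** `F⟨c⟩ = twist c F : X.Modules` has sections

  `Γ(F⟨c⟩, V) = { (s_x)_x : s_x ∈ Γ(F, V ∩ U_x), s_x = g_{xy} · s_y on every W ⊆ V ∩ U_x ∩ U_y }`

— the coordinates of a section of `F ⊗ M` in the local generators `t_x` of `M` (`t_w = g_{zw} t_z`,
`LineBundleOfCocycle.lineBundleGen_eq_smul`); for `F = 𝒪_X` the relation is literally that of `lineBundle c`. It is
a sub-`𝒪_X`-module of `Π_x (j_x)_*(F|_{U_x})` (`piModule c F`), a sheaf because `F` is. The sequel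
`UntwistCocycleTwistEquivalence.lean` makes `F ↦ F⟨c⟩` an additive functor and an autoEQUIVALENCE of `X.Modules`
(inverse `c⁻¹`, explicit unit `F ≅ F⟨c⟩⟨c⁻¹⟩`), so that `θ` of the untwisted reading becomes a CONSTRUCTED
bijection (sheaf level via `UntwistExtEquivalence`, complex level via `UntwistDerivedAdjunction` /
`UntwistComplexSigma` with `E₀′ := E₀⟨c⟩` termwise) for ANY module / cochain complex — no local freeness needed,
so the two-term STEP-0 object (`H⁻¹ = K`, `H⁰ = 𝒪_{X×0̂}`) is covered.

NUMBERS (the intended instance; nothing of it is used here): `X = X₀ = A₀` the `g = 4` anchor, `c` a cocycle of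
`M_B` (`c₁(M_B) = B`, integral on the fibre: `B₀ = c₁(P)/2`, t-12's lemma «integral iff `m` even»), `F = E₀`
termwise; which twist: `- ⊗ M_B`; which class: `ch(E₀⟨c⟩) = ch(E₀)·exp(B)` (`UntwistKappaClass.lean`).

## Contents (everything proved; 0 named facts; 0 sorry)

* `PointFamily c F V = Π_x Γ(F, V ∩ U_x)`, restriction, `𝒪_X(V)`-action; `piModule c F : X.Modules`
  (`isSheaf_piPresheaf`: componentwise gluing in `F`).
* `twistFamilies c F V` — the set of families with `s_x = g_{xy} · s_y`; stable under `0`, `+`, the action,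
  restriction, and LOCAL (`mem_twistFamilies_of_locally`); `isSheaf_twistSubmodule`.
* **`twist c F : X.Modules`** (`F⟨c⟩`), `twistι`, components `comp`, `mkFamily`, extensionality and the
  componentwise formulas `comp_map`, `comp_smul`, `comp_add`; `homMkTwist` — morphisms `M ⟶ F⟨c⟩` from section
  formulas.

Not anywhere yet: `F⟨c⟩ ≅ F ⊗ lineBundle c` for the sheafified tensor product (not needed: consumers TAKE
`E₀′ := E₀⟨c⟩`), local freeness of `F⟨c⟩` for `F` locally free, the Leibniz rule (stays a binder downstream).

## References

* R. Hartshorne, *Algebraic Geometry*, GTM 52 (1977), II Ex. 1.22 (glueing sheaves), III Ex. 4.5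
  (`Pic X ≅ Ȟ¹(X, 𝒪_X^×)`). [Hartshorne1977]
* The Stacks Project, Tag 01CR (invertible modules), Tag 00AK (glueing sheaves). [StacksProject]
-/

noncomputable section

open CategoryTheory AlgebraicGeometry TopologicalSpace Opposite

namespace Summit.Ventures.HSemireg

open Literature.AlgebraicGeometry.Modules

universe u

variable {X : Scheme.{u}} (c : UnitCocycle X) (F : X.Modules)

namespace CocycleTwist

/-! ### Restriction calculus in a module (arrow form; `presheaf_map_map` is the tree's `SheafHom` lemma) -/

/-- Morphisms of sheaves of modules commute with restriction along a morphism of opens, elementwise.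
[folklore] -/
theorem app_map_apply {M M' : X.Modules} (φ : M ⟶ M') {V W : X.Opens} (i : W ⟶ V) (m : Γ(M, V)) :
    M'.presheaf.map i.op (φ.app V m) = φ.app W (M.presheaf.map i.op m) :=
  (ConcreteCategory.congr_hom (φ.mapPresheaf.naturality i.op) m).symm

/-! ### The product of the pieces `Π_x Γ(F, V ∩ U_x)` -/

/-- Families `(s_x)_x`, `s_x ∈ Γ(F, V ∩ U_x)`, indexed by the points of `X` (the cover of the cocycle
is point-indexed). [folklore] -/
abbrev PointFamily (V : X.Opens) : Type u := ∀ x : X, Γ(F, V ⊓ c.U x)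

/-- Restriction of point families along `W ⊆ V`, componentwise. [folklore] -/
def PointFamily.res {V W : X.Opens} (h : W ≤ V) (s : PointFamily c F V) : PointFamily c F W :=
  fun x => F.presheaf.map (homOfLE (inf_le_inf_right (c.U x) h)).op (s x)

/-- Components of a restricted family. [folklore] -/
@[simp]
theorem PointFamily.res_apply {V W : X.Opens} (h : W ≤ V) (s : PointFamily c F V) (x : X) :
    PointFamily.res c F h s x = F.presheaf.map (homOfLE (inf_le_inf_right (c.U x) h)).op (s x) := rfl

/-- The `𝒪_X(V)`-module structure on point families: `a • (s_x) = (a|_{V ∩ U_x} • s_x)`. [folklore] -/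
@[reducible]
def PointFamily.module (V : X.Opens) : Module Γ(X, V) (PointFamily c F V) :=
  @Pi.module X (fun x => Γ(F, V ⊓ c.U x)) Γ(X, V) _ _ fun x =>
    Module.compHom _ (X.presheaf.map (homOfLE (inf_le_left : V ⊓ c.U x ≤ V)).op).hom

/-- The presheaf of abelian groups `V ↦ Π_x Γ(F, V ∩ U_x)`. [folklore] -/
def piPresheafAb : TopCat.Presheaf Ab X where
  obj V := AddCommGrpCat.of (PointFamily c F V.unop)
  map i := AddCommGrpCat.ofHom
    { toFun := PointFamily.res c F i.unop.le
      map_zero' := funext fun _ => map_zero _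
      map_add' := fun f g => funext fun x => map_add _ (f x) (g x) }
  map_id V := by
    refine AddCommGrpCat.ext fun f => funext fun x => ?_
    change F.presheaf.map _ (f x) = f x
    have : (homOfLE (inf_le_inf_right (c.U x) (𝟙 V).unop.le)).op = 𝟙 (op (V.unop ⊓ c.U x)) :=
      Subsingleton.elim _ _
    rw [this, F.presheaf.map_id]; rfl
  map_comp i i' := by
    refine AddCommGrpCat.ext fun f => funext fun x => ?_
    change F.presheaf.map _ (f x) = F.presheaf.map _ (F.presheaf.map _ (f x))
    rw [presheaf_map_map]
    rfl

/-- The presheaf of `𝒪_X`-modules `V ↦ Π_x Γ(F, V ∩ U_x)`. [folklore] -/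
def piPresheaf : X.PresheafOfModules :=
  @PresheafOfModules.ofPresheaf _ _ X.ringCatSheaf.obj (piPresheafAb c F)
    (fun V => PointFamily.module c F V.unop)
    (fun V W i a f => by
      -- restriction is semilinear over restriction of functions: `(a • s)_x| = a|| • s_x|`
      letI := PointFamily.module c F V.unop
      letI := PointFamily.module c F W.unop
      funext x
      change F.presheaf.map (homOfLE (inf_le_inf_right (c.U x) i.unop.le)).op
          (X.presheaf.map (homOfLE (inf_le_left : V.unop ⊓ c.U x ≤ V.unop)).op a • f x) =
        X.presheaf.map (homOfLE (inf_le_left : W.unop ⊓ c.U x ≤ W.unop)).op (X.presheaf.map i a) •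
          F.presheaf.map (homOfLE (inf_le_inf_right (c.U x) i.unop.le)).op (f x)
      rw [Scheme.Modules.map_smul, ← CategoryTheory.comp_apply, ← CategoryTheory.comp_apply,
        ← Functor.map_comp, ← Functor.map_comp]
      rfl)

/-- **`V ↦ Π_x Γ(F, V ∩ U_x)` is a sheaf** (componentwise gluing in `F` on the covers `(V_a ∩ U_x)_a`).
[folklore] -/
theorem isSheaf_piPresheaf : TopCat.Presheaf.IsSheaf (piPresheaf c F).presheaf := by
  change TopCat.Presheaf.IsSheaf (piPresheafAb c F)
  rw [TopCat.Presheaf.isSheaf_iff_isSheafUniqueGluing]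
  intro κ V sf hsf
  let G : TopCat.Sheaf Ab X := ⟨F.presheaf, Scheme.Modules.isSheaf F⟩
  have hcov : ∀ x : X, iSup V ⊓ c.U x ≤ ⨆ a, V a ⊓ c.U x := fun x => by
    rw [← iSup_inf_eq]
  have hsf' : ∀ x : X, TopCat.Presheaf.IsCompatible G.1 (fun a => V a ⊓ c.U x) fun a => sf a x := by
    intro x a b
    have h := congrFun (hsf a b) x
    change F.presheaf.map _ (sf a x) = F.presheaf.map _ (sf b x) at h
    change F.presheaf.map _ (sf a x) = F.presheaf.map _ (sf b x)
    have e1 : V a ⊓ c.U x ⊓ (V b ⊓ c.U x) = V a ⊓ V b ⊓ c.U x := by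
      apply le_antisymm
      · exact le_inf (le_inf (inf_le_left.trans inf_le_left) (inf_le_right.trans inf_le_left))
          (inf_le_left.trans inf_le_right)
      · exact le_inf (inf_le_inf_right _ inf_le_left) (inf_le_inf_right _ inf_le_right)
    have key := congrArg (F.presheaf.map (homOfLE e1.le).op) h
    rw [presheaf_map_map, presheaf_map_map] at key
    exact key
  have H := fun x => G.existsUnique_gluing' (fun a => V a ⊓ c.U x) (iSup V ⊓ c.U x)
    (fun a => homOfLE (inf_le_inf_right _ (le_iSup V a))) (hcov x) (fun a => sf a x) (hsf' x)
  refine ⟨fun x => (H x).exists.choose, fun a => funext fun x => (H x).exists.choose_spec a,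
    fun t ht => funext fun x => (H x).unique (fun a => ?_) (H x).exists.choose_spec⟩
  exact congrFun (ht a) x

/-- **The product of the pieces `Π_x (j_x)_*(F|_{U_x})`** as a sheaf of `𝒪_X`-modules: sections over `V`
are the point families `(s_x ∈ Γ(F, V ∩ U_x))_x`, definitionally. [folklore] -/
def piModule : X.Modules where
  val := piPresheaf c F
  isSheaf := isSheaf_piPresheaf c F

/-- Restriction in `piModule` is componentwise. [folklore] -/
theorem piModule_map_apply {V W : X.Opens} (h : W ≤ V) (s : Γ(piModule c F, V)) (x : X) :
    ((piModule c F).presheaf.map (homOfLE h).op s) x =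
      F.presheaf.map (homOfLE (inf_le_inf_right (c.U x) h)).op (s x) := rfl

/-- The action on `piModule` is componentwise. [folklore] -/
theorem piModule_smul_apply {V : X.Opens} (a : Γ(X, V)) (s : Γ(piModule c F, V)) (x : X) :
    (a • s) x = X.presheaf.map (homOfLE (inf_le_left : V ⊓ c.U x ≤ V)).op a • s x := rfl

/-! ### The twisting relation `s_x = g_{xy} · s_y` and the subsheaf `F⟨c⟩` -/

variable {c F}

/-- **The gluing relation of `F ⊗ M`** in the local generators of `M = lineBundle c`: the set of point
families `(s_x)` over `V` with `s_x = g_{xy} · s_y` on every open `W ⊆ V ∩ U_x ∩ U_y` (a `Set`, i.e. a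
predicate on families; nothing is asserted). [cite: Hartshorne1977, II Ex. 1.22 (glueing condition)] -/
def twistFamilies (c : UnitCocycle X) (F : X.Modules) (V : X.Opens) : Set (PointFamily c F V) :=
  {s | ∀ (x y : X) ⦃W : X.Opens⦄ (hW : W ≤ V) (hx : W ≤ c.U x) (hy : W ≤ c.U y),
    F.presheaf.map (homOfLE (le_inf hW hx)).op (s x) =
      c.g x y W hx hy • F.presheaf.map (homOfLE (le_inf hW hy)).op (s y)}

namespace twistFamilies

variable {V : X.Opens}

/-- The relation of a member, as a function. [folklore] -/
theorem rel {s : PointFamily c F V} (hs : s ∈ twistFamilies c F V) (x y : X) ⦃W : X.Opens⦄ (hW : W ≤ V)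
    (hx : W ≤ c.U x) (hy : W ≤ c.U y) :
    F.presheaf.map (homOfLE (le_inf hW hx)).op (s x) =
      c.g x y W hx hy • F.presheaf.map (homOfLE (le_inf hW hy)).op (s y) :=
  hs x y hW hx hy

/-- `0` satisfies the relation. [folklore] -/
theorem zero_mem : (0 : PointFamily c F V) ∈ twistFamilies c F V := fun x y W hW hx hy => by
  simp only [Pi.zero_apply, map_zero, smul_zero]

/-- The relation is stable under addition. [folklore] -/
theorem add_mem {s t : PointFamily c F V} (hs : s ∈ twistFamilies c F V) (ht : t ∈ twistFamilies c F V) :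
    s + t ∈ twistFamilies c F V := fun x y W hW hx hy => by
  simp only [Pi.add_apply, map_add, smul_add]
  rw [rel hs x y hW hx hy, rel ht x y hW hx hy]

/-- The relation is stable under the action (of `𝒪_X(V)` on `Γ(piModule c F, V)`). [folklore] -/
theorem smul_mem (a : Γ(X, V)) {s : Γ(piModule c F, V)} (hs : s ∈ twistFamilies c F V) :
    a • s ∈ twistFamilies c F V := fun x y W hW hx hy => by
  rw [piModule_smul_apply, piModule_smul_apply, Scheme.Modules.map_smul, Scheme.Modules.map_smul,
    ← CategoryTheory.comp_apply, ← Functor.map_comp, ← CategoryTheory.comp_apply, ← Functor.map_comp,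
    rel hs x y hW hx hy, smul_smul, smul_smul, mul_comm]
  rfl

/-- The relation restricts. [folklore] -/
theorem res_mem {s : PointFamily c F V} (hs : s ∈ twistFamilies c F V) {W : X.Opens} (h : W ≤ V) :
    PointFamily.res c F h s ∈ twistFamilies c F W := fun x y W' hW' hx hy => by
  rw [PointFamily.res_apply, PointFamily.res_apply, presheaf_map_map, presheaf_map_map]
  exact rel hs x y (hW'.trans h) hx hy

end twistFamilies

variable (c F)

/-- The twist families over `V` form a submodule. [folklore] -/
def twistSubmoduleObj (V : X.Opens) : Submodule Γ(X, V) Γ(piModule c F, V) where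
  carrier := twistFamilies c F V
  zero_mem' := twistFamilies.zero_mem
  add_mem' := twistFamilies.add_mem
  smul_mem' := fun a _ hs => twistFamilies.smul_mem a hs

/-- **`V ↦ F⟨c⟩(V)` is stable under restriction.** [folklore] -/
def twistSubmodule : PresheafOfModules.Submodule (piModule c F).val where
  obj V := twistSubmoduleObj c F V.unop
  map {V W} i := fun s hs => by
    change PointFamily.res c F i.unop.le s ∈ twistFamilies c F W.unop
    exact twistFamilies.res_mem hs i.unop.le

/-- Restrictions of the cocycle are the cocycle (Mathlib-map form of `UnitCocycle.map_g`). [folklore] -/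
theorem map_g_apply (x y : X) {V W : X.Opens} (hx : V ≤ c.U x) (hy : V ≤ c.U y) (i : W ≤ V) :
    X.presheaf.map (homOfLE i).op (c.g x y V hx hy) = c.g x y W (i.trans hx) (i.trans hy) :=
  c.map_g x y hx hy i

/-- A family over `⨆ V_a` satisfying the relation on every `V_a` satisfies it (locality in `F`). [folklore] -/
theorem mem_twistFamilies_of_locally {κ : Type u} (V : κ → X.Opens) (s : PointFamily c F (iSup V))
    (hs : ∀ a, PointFamily.res c F (le_iSup V a) s ∈ twistFamilies c F (V a)) :
    s ∈ twistFamilies c F (iSup V) := by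
  intro x y W hW hx hy
  have hcov : W ≤ ⨆ a, W ⊓ V a := by
    rw [← inf_iSup_eq]
    exact le_inf le_rfl hW
  apply TopCat.Sheaf.eq_of_locally_eq' (⟨F.presheaf, Scheme.Modules.isSheaf F⟩ : TopCat.Sheaf Ab X)
    (fun a => W ⊓ V a) W (fun a => homOfLE inf_le_left) hcov
  intro a
  change F.presheaf.map _ (F.presheaf.map _ _) = F.presheaf.map _ (_ • F.presheaf.map _ _)
  rw [Scheme.Modules.map_smul, presheaf_map_map, presheaf_map_map, map_g_apply]
  have key := twistFamilies.rel (hs a) x y (W := W ⊓ V a) inf_le_right (inf_le_left.trans hx)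
    (inf_le_left.trans hy)
  rw [PointFamily.res_apply, PointFamily.res_apply, presheaf_map_map, presheaf_map_map] at key
  exact key

/-- **`V ↦ F⟨c⟩(V)` is a sheaf.** [folklore] -/
theorem isSheaf_twistSubmodule :
    TopCat.Presheaf.IsSheaf (twistSubmodule c F).toPresheafOfModules.presheaf := by
  rw [TopCat.Presheaf.isSheaf_iff_isSheafUniqueGluing]
  intro κ V sf hsf
  let M := piModule c F
  have hsf' : TopCat.Presheaf.IsCompatible M.presheaf V fun a => (sf a).val := fun a b =>
    congrArg Subtype.val (hsf a b)
  obtain ⟨s, hs, huniq⟩ := (Scheme.Modules.isSheaf M).isSheafUniqueGluing V (fun a => (sf a).val) hsf'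
  have hstw : s ∈ twistFamilies c F (iSup V) :=
    mem_twistFamilies_of_locally c F V s fun a => by
      have e : (homOfLE (le_iSup V a)).op = (Opens.leSupr V a).op := Subsingleton.elim _ _
      have hsa := hs a
      rw [← e] at hsa
      have : PointFamily.res c F (le_iSup V a) s = (sf a).val := hsa
      rw [this]; exact (sf a).2
  refine ⟨⟨s, hstw⟩, fun a => Subtype.ext (hs a), fun t ht => Subtype.ext (huniq t.val fun a => ?_)⟩
  exact congrArg Subtype.val (ht a)

/-- **The cocycle twist `F⟨c⟩ = F ⊗ lineBundle c`** of an `𝒪_X`-module by a Čech cocycle of units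
`c = (U_x, g_{xy})`, by gluing: families `(s_x ∈ Γ(F, V ∩ U_x))_x` with `s_x = g_{xy} · s_y` (Hartshorne II
Ex. 1.22; for `F = 𝒪_X` the relation of `Modules/LineBundleOfCocycle.lineBundle c`).
[cite: Hartshorne1977, II Ex. 1.22 and III Ex. 4.5] -/
def twist : X.Modules :=
  ⟨(twistSubmodule c F).toPresheafOfModules, isSheaf_twistSubmodule c F⟩

/-- The inclusion `F⟨c⟩ ⟶ Π_x (j_x)_*(F|_{U_x})`. [folklore] -/
def twistι : twist c F ⟶ piModule c F := ⟨(twistSubmodule c F).ι⟩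

/-- The `x`-component `s_x ∈ Γ(F, V ∩ U_x)` of a section `s` of `F⟨c⟩` over `V`. [folklore] -/
def comp {V : X.Opens} (s : Γ(twist c F, V)) (x : X) : Γ(F, V ⊓ c.U x) :=
  (s : twistSubmoduleObj c F V).val x

/-- Sections of `F⟨c⟩` satisfy the twisting relation. [folklore] -/
theorem comp_mem {V : X.Opens} (s : Γ(twist c F, V)) : comp c F s ∈ twistFamilies c F V :=
  (s : twistSubmoduleObj c F V).2

/-- The twisting relation of a section of `F⟨c⟩`, spelled out: `s_x| = g_{xy} · s_y|`. [folklore] -/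
theorem comp_rel {V : X.Opens} (s : Γ(twist c F, V)) (x y : X) ⦃W : X.Opens⦄ (hW : W ≤ V)
    (hx : W ≤ c.U x) (hy : W ≤ c.U y) :
    F.presheaf.map (homOfLE (le_inf hW hx)).op (comp c F s x) =
      c.g x y W hx hy • F.presheaf.map (homOfLE (le_inf hW hy)).op (comp c F s y) :=
  comp_mem c F s x y hW hx hy

/-- Extensionality for sections of `F⟨c⟩`. [folklore] -/
@[ext]
theorem twist_ext {V : X.Opens} {s t : Γ(twist c F, V)} (h : ∀ x, comp c F s x = comp c F t x) : s = t :=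
  Subtype.ext (funext h)

/-- A family satisfying the relation is a section of `F⟨c⟩`. [folklore] -/
def mkFamily {V : X.Opens} (s : PointFamily c F V) (hs : s ∈ twistFamilies c F V) : Γ(twist c F, V) :=
  (⟨s, hs⟩ : twistSubmoduleObj c F V)

/-- Components of `mkFamily`. [folklore] -/
@[simp]
theorem comp_mkFamily {V : X.Opens} (s : PointFamily c F V) (hs : s ∈ twistFamilies c F V) (x : X) :
    comp c F (mkFamily c F s hs) x = s x := rfl

/-- Restriction in `F⟨c⟩` is componentwise. [folklore] -/
@[simp]
theorem comp_map {V W : X.Opens} (h : W ≤ V) (s : Γ(twist c F, V)) (x : X) :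
    comp c F ((twist c F).presheaf.map (homOfLE h).op s) x =
      F.presheaf.map (homOfLE (inf_le_inf_right (c.U x) h)).op (comp c F s x) := rfl

/-- The action on `F⟨c⟩` is componentwise. [folklore] -/
@[simp]
theorem comp_smul {V : X.Opens} (a : Γ(X, V)) (s : Γ(twist c F, V)) (x : X) :
    comp c F (a • s) x = X.presheaf.map (homOfLE (inf_le_left : V ⊓ c.U x ≤ V)).op a • comp c F s x := rfl

/-- Components are additive. [folklore] -/
@[simp]
theorem comp_add {V : X.Opens} (s t : Γ(twist c F, V)) (x : X) :
    comp c F (s + t) x = comp c F s x + comp c F t x := rfl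

/-- Components of zero. [folklore] -/
@[simp]
theorem comp_zero {V : X.Opens} (x : X) : comp c F (0 : Γ(twist c F, V)) x = 0 := rfl

/-- The inclusion into the product is the family of components. [folklore] -/
theorem twistι_app_apply (V : X.Opens) (s : Γ(twist c F, V)) : (twistι c F).app V s = comp c F s := rfl

/-! ### Morphisms into `F⟨c⟩` from section formulas -/

/-- **Constructor for morphisms `M ⟶ F⟨c⟩`** from additive maps on sections commuting with restriction
and with the action (the `PresheafOfModules.homMk` pattern, packaged). [folklore] -/
def homMkTwist {M : X.Modules} (Φ : ∀ V : X.Opens, Γ(M, V) →+ Γ(twist c F, V))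
    (hres : ∀ (V W : X.Opens) (h : W ≤ V) (m : Γ(M, V)) (x : X),
      comp c F (Φ W (M.presheaf.map (homOfLE h).op m)) x =
        F.presheaf.map (homOfLE (inf_le_inf_right (c.U x) h)).op (comp c F (Φ V m) x))
    (hsmul : ∀ (V : X.Opens) (a : Γ(X, V)) (m : Γ(M, V)) (x : X),
      comp c F (Φ V (a • m)) x =
        X.presheaf.map (homOfLE (inf_le_left : V ⊓ c.U x ≤ V)).op a • comp c F (Φ V m) x) :
    M ⟶ twist c F where
  val := PresheafOfModules.homMk
    { app := fun V => AddCommGrpCat.ofHom (Φ V.unop)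
      naturality := fun V W i => by
        ext m
        apply twist_ext
        intro x
        change comp c F (Φ W.unop (M.presheaf.map i m)) x = F.presheaf.map _ (comp c F (Φ V.unop m) x)
        have ei : i = (homOfLE i.unop.le).op := Subsingleton.elim _ _
        rw [ei]
        exact hres V.unop W.unop i.unop.le m x }
    (fun V a m => twist_ext c F fun x => (hsmul V.unop a m x).trans (comp_smul c F a (Φ V.unop m) x).symm)

/-- Sections of `homMkTwist`: the given maps. [folklore] -/
@[simp]
theorem homMkTwist_app {M : X.Modules} (Φ : ∀ V : X.Opens, Γ(M, V) →+ Γ(twist c F, V))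
    (hres : ∀ (V W : X.Opens) (h : W ≤ V) (m : Γ(M, V)) (x : X),
      comp c F (Φ W (M.presheaf.map (homOfLE h).op m)) x =
        F.presheaf.map (homOfLE (inf_le_inf_right (c.U x) h)).op (comp c F (Φ V m) x))
    (hsmul : ∀ (V : X.Opens) (a : Γ(X, V)) (m : Γ(M, V)) (x : X),
      comp c F (Φ V (a • m)) x =
        X.presheaf.map (homOfLE (inf_le_left : V ⊓ c.U x ≤ V)).op a • comp c F (Φ V m) x)
    (V : X.Opens) (m : Γ(M, V)) : (homMkTwist c F Φ hres hsmul).app V m = Φ V m := rfl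

end CocycleTwist

end Summit.Ventures.HSemireg

end
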